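import Mathlib.LinearAlgebra.PiTensorProduct.Basic
import Mathlib.LinearAlgebra.PiTensorProduct.Finite
import Mathlib.Analysis.Calculus.Deriv.Mul
import Mathlib.Analysis.Calculus.Deriv.Add
import Literature.NumberTheory.Automorphic.GKModuleOfDifferentiableRep
import HarnessLib

/-!
# Tensor products `⨂ᵢ Eᵢ` of finitely many finite-dimensional differentiable representations

Topic `NumberTheory/Automorphic`; namespace
`Literature.NumberTheory.Automorphic.RealMatrixGroup.PiTensor`.
Definitions with bodies and theorems; no named fact, no `sorry`.  Companion of
`GKModuleOfDifferentiableRep` (`IsDifferentiableRep`, `.isGKModule`).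

For a linear real group `G` and finitely many representations `τ i` of `G` on complex vector spaces
`E i` with differentials `dτ i` (Mathlib's `PiTensorProduct`, `⨂[ℂ] i, E i`):

* `PiTensor.slot i u` — the operator `1 ⊗ ⋯ ⊗ u ⊗ ⋯ ⊗ 1` (`u` in slot `i`); `slot_tprod`,
  additivity/homogeneity in `u` (`slot_add`, `slot_smul`, `slot_sub`), `slot_mul_same`, and
  `slot_comm` (operators in different slots commute);
* `PiTensor.piRep G τ : Representation ℂ G (⨂ᵢ Eᵢ)`, `g ↦ ⨂ᵢ τᵢ(g)` (`piRep_tprod`), and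
  **the Leibniz differential** `PiTensor.piLie G dτ : 𝔤 →ₗ⁅ℝ⁆ End (⨂ᵢ Eᵢ)`,
  `X ↦ ∑ᵢ 1 ⊗ ⋯ ⊗ dτᵢ(X) ⊗ ⋯ ⊗ 1` — a morphism of real Lie algebras (`piLie_tprod`:
  `X (⨂ᵢ vᵢ) = ∑ᵢ v₁ ⊗ ⋯ ⊗ dτᵢ(X) vᵢ ⊗ ⋯`)
  [cite: KnappVogan1995, §II.3 (2.38) (tensor products)];
* `PiTensor.expand` — `ℓ (⨂ᵢ vᵢ) = ∑_a (∏ᵢ bᵢ^*_(aᵢ)(vᵢ)) ℓ (⨂ᵢ bᵢ(aᵢ))` in bases `bᵢ`;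
* `PiTensor.isDifferentiableRep` — **`⨂ᵢ Eᵢ` is differentiable with the Leibniz differential**
  when the `Eᵢ` are finite-dimensional and the `(τ i, dτ i)` differentiable: matrix coefficients
  expand into finite sums of products of matrix coefficients of the factors (continuity), and the
  derivative of a product is the Leibniz sum (`HasDerivAt.fun_finsetProd`); hence
  `PiTensor.isGKModule` — **restricted to `K`, a `(𝔤, K)`-module**
  [cite: BorelWallach2000, 0 §2.4–2.5].

With the `φ`-standard representations (`GKModulePhiStandardRep`) as factors these are the tensor
powers in which the algebraic coefficient systems `V_λ` (Weyl modules, `GLnCohomology.coeffRepGL`)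
of the cohomology of arithmetic groups live.

## Mathlib / Literature search

`PiTensorProduct.map`/`map_tprod`/`map_update_add`/`map_update_smul`/`map_mul`/`map_one`,
`MultilinearMap.map_sum`, `map_smul_univ`, `Finset.prod_update_of_mem`,
`HasDerivAt.fun_finsetProd`,
`HasDerivAt.fun_sum`, `PiTensorProduct.finite` (Mathlib).  Mathlib has no Lie-algebra (Leibniz)
action on `PiTensorProduct` (`lean search 'PiTensorProduct.*lie|leibniz'`: no hits).

## References

* A. W. Knapp, D. A. Vogan (1995), §II.3 (2.38) (held) [KnappVogan1995].
* A. Borel, N. Wallach (2000), 0 §2.3–2.5 (held) [BorelWallach2000].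
-/

noncomputable section

namespace Literature.NumberTheory.Automorphic

open Module
open scoped TensorProduct

-- Mathlib idiom (as in `GKModules`): commutator bracket on `Module.End`
attribute [local instance 100] LieRing.ofAssociativeRing

variable {A : Type*} [NormedCommRing A] [NormedAlgebra ℝ A] [NormedAlgebra ℚ A] [CompleteSpace A]
  [StarRing A] {N : Type*} [Fintype N] [DecidableEq N] (G : RealMatrixGroup A N)
  {ι : Type*} [Fintype ι] [DecidableEq ι] {E : ι → Type*} [∀ i, AddCommGroup (E i)]
  [∀ i, Module ℂ (E i)]
  (τ : ∀ i, Representation ℂ G.carrier (E i)) (dτ : ∀ i, G.lie →ₗ⁅ℝ⁆ Module.End ℂ (E i))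

namespace RealMatrixGroup

/-- `exp (0 · X) = 1` (a local copy of a three-line lemma scattered through the automorphic
files, to keep this file's imports light). [folklore] -/
private theorem expMem_zero_smul_pi (X : G.lie) : G.expMem ((0 : ℝ) • X) = 1 := by
  refine Subtype.ext (Units.ext ?_)
  simp only [coe_expMem, coe_expGL, zero_smul, ZeroMemClass.coe_zero, NormedSpace.exp_zero,
    Subgroup.coe_one, Units.val_one]

namespace PiTensor

/-! #### Slot operators `1 ⊗ ⋯ ⊗ u ⊗ ⋯ ⊗ 1` -/

omit [Fintype ι] in
/-- The operator `u` in the `i`-th slot of `⨂ᵢ Eᵢ`. [folklore] -/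
def slot (i : ι) (u : E i →ₗ[ℂ] E i) : Module.End ℂ (⨂[ℂ] i, E i) :=
  PiTensorProduct.map (Function.update (fun j => (1 : E j →ₗ[ℂ] E j)) i u)

omit [Fintype ι] in
/-- The slot operator on pure tensors. [folklore] -/
theorem slot_tprod (i : ι) (u : E i →ₗ[ℂ] E i) (f : ∀ i, E i) :
    slot i u (PiTensorProduct.tprod ℂ f) =
      PiTensorProduct.tprod ℂ (Function.update f i (u (f i))) := by
  rw [slot, PiTensorProduct.map_tprod]
  congr 1
  funext j
  by_cases hji : j = i
  · subst hji
    simp only [Function.update_self]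
  · simp only [Function.update_of_ne hji, Module.End.one_apply]

omit [Fintype ι] in
/-- Additivity in the slot. [folklore] -/
theorem slot_add (i : ι) (u v : E i →ₗ[ℂ] E i) : slot i (u + v) = slot i u + slot i v :=
  PiTensorProduct.map_update_add _ i u v

omit [Fintype ι] in
/-- Homogeneity in the slot. [folklore] -/
theorem slot_smul (i : ι) (c : ℂ) (u : E i →ₗ[ℂ] E i) : slot i (c • u) = c • slot i u :=
  PiTensorProduct.map_update_smul _ i c u

omit [Fintype ι] in
/-- Subtraction in the slot. [folklore] -/
theorem slot_sub (i : ι) (u v : E i →ₗ[ℂ] E i) : slot i (u - v) = slot i u - slot i v :=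
  eq_sub_of_add_eq (by rw [← slot_add, sub_add_cancel])

omit [Fintype ι] in
/-- Composition in the same slot. [folklore] -/
theorem slot_mul_same (i : ι) (u v : E i →ₗ[ℂ] E i) : slot i u * slot i v = slot i (u * v) := by
  rw [slot, slot, slot, ← PiTensorProduct.map_mul]
  congr 1
  funext k
  by_cases hki : k = i
  · subst hki
    simp only [Function.update_self]
  · simp only [Function.update_of_ne hki, mul_one]

omit [Fintype ι] in
/-- Operators in different slots commute. [folklore] -/
theorem slot_comm {i j : ι} (hij : i ≠ j) (u : E i →ₗ[ℂ] E i) (v : E j →ₗ[ℂ] E j) :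
    slot i u * slot j v = slot j v * slot i u := by
  rw [slot, slot, ← PiTensorProduct.map_mul, ← PiTensorProduct.map_mul]
  congr 1
  funext k
  by_cases hki : k = i
  · subst hki
    simp only [Function.update_self, Function.update_of_ne hij, one_mul, mul_one]
  · by_cases hkj : k = j
    · subst hkj
      simp only [Function.update_self, Function.update_of_ne hki, one_mul, mul_one]
    · simp only [Function.update_of_ne hki, Function.update_of_ne hkj]

/-! #### The tensor product representation and its Leibniz differential -/

/-- `g ↦ ⨂ᵢ τᵢ(g)` on `⨂ᵢ Eᵢ`. [cite: KnappVogan1995, §II.3 (2.38)] -/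
def piRep : Representation ℂ G.carrier (⨂[ℂ] i, E i) where
  toFun g := PiTensorProduct.map fun i => τ i g
  map_one' := by
    simp only [map_one]
    exact PiTensorProduct.map_one
  map_mul' g h := by
    simp only [map_mul]
    exact PiTensorProduct.map_mul _ _

omit [Fintype ι] [DecidableEq ι] in
/-- On pure tensors. [folklore] -/
@[simp] theorem piRep_tprod (g : G.carrier) (f : ∀ i, E i) :
    piRep G τ g (PiTensorProduct.tprod ℂ f) = PiTensorProduct.tprod ℂ fun i => τ i g (f i) :=
  PiTensorProduct.map_tprod _ _

/-- The Leibniz differential `X ↦ ∑ᵢ 1 ⊗ ⋯ ⊗ dτᵢ(X) ⊗ ⋯ ⊗ 1`.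
[cite: KnappVogan1995, §II.3 (2.38)] -/
def piLie : G.lie →ₗ⁅ℝ⁆ Module.End ℂ (⨂[ℂ] i, E i) where
  toFun X := ∑ i, slot i (dτ i X)
  map_add' X Y := by
    simp only [map_add, slot_add, Finset.sum_add_distrib]
  map_smul' t X := by
    change ∑ i, slot i (dτ i (t • X)) = (t : ℂ) • ∑ i, slot i (dτ i X)
    rw [Finset.smul_sum]
    refine Finset.sum_congr rfl fun i _ => ?_
    rw [map_smul, ← slot_smul]
    rfl
  map_lie' {X Y} := by
    have hcomm : ∀ i j, i ≠ j →
        slot i (dτ i X) * slot j (dτ j Y) = slot j (dτ j Y) * slot i (dτ i X) :=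
      fun i j h => slot_comm h _ _
    calc ∑ i, slot i (dτ i ⁅X, Y⁆)
        = ∑ i, (slot i (dτ i X) * slot i (dτ i Y) - slot i (dτ i Y) * slot i (dτ i X)) := by
          refine Finset.sum_congr rfl fun i _ => ?_
          rw [LieHom.map_lie, Ring.lie_def, slot_sub, slot_mul_same, slot_mul_same]
      _ = ∑ i, ∑ j, (slot i (dτ i X) * slot j (dτ j Y) - slot j (dτ j Y) * slot i (dτ i X)) := by
          refine Finset.sum_congr rfl fun i _ => ?_
          rw [Finset.sum_eq_single i (fun j _ hji => by rw [hcomm i j (Ne.symm hji), sub_self])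
            (fun hi => absurd (Finset.mem_univ i) hi)]
      _ = (∑ i, slot i (dτ i X)) * (∑ j, slot j (dτ j Y)) -
            (∑ j, slot j (dτ j Y)) * (∑ i, slot i (dτ i X)) := by
          rw [Finset.sum_mul_sum, Finset.sum_mul_sum,
            Finset.sum_comm (f := fun j i => slot j (dτ j Y) * slot i (dτ i X)),
            ← Finset.sum_sub_distrib]
          refine Finset.sum_congr rfl fun i _ => ?_
          rw [Finset.sum_sub_distrib]
      _ = ⁅∑ i, slot i (dτ i X), ∑ j, slot j (dτ j Y)⁆ := (Ring.lie_def _ _).symm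

/-- Unfolding. [folklore] -/
theorem piLie_apply (X : G.lie) : piLie G dτ X = ∑ i, slot i (dτ i X) := rfl

/-- The Leibniz rule on pure tensors. [folklore] -/
theorem piLie_tprod (X : G.lie) (f : ∀ i, E i) :
    piLie G dτ X (PiTensorProduct.tprod ℂ f) =
      ∑ i, PiTensorProduct.tprod ℂ (Function.update f i (dτ i X (f i))) := by
  rw [piLie_apply, LinearMap.sum_apply]
  exact Finset.sum_congr rfl fun i _ => slot_tprod i _ f

/-! #### Differentiability -/

/-- Expansion of `ℓ (⨂ᵢ vᵢ)` in bases `bᵢ` of the `Eᵢ`. [folklore] -/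
theorem expand (ℓ : Dual ℂ (⨂[ℂ] i, E i)) {κ : ι → Type*} [∀ i, Fintype (κ i)]
    (b : ∀ i, Basis (κ i) ℂ (E i)) (v : ∀ i, E i) :
    ℓ (PiTensorProduct.tprod ℂ v) =
      ∑ a : (∀ i, κ i), (∏ i, (b i).coord (a i) (v i)) *
        ℓ (PiTensorProduct.tprod ℂ fun i => b i (a i)) := by
  have hv : v = fun i => ∑ k, (b i).repr (v i) k • b i k :=
    funext fun i => ((b i).sum_repr (v i)).symm
  conv_lhs => rw [hv]
  rw [MultilinearMap.map_sum (PiTensorProduct.tprod ℂ) fun i k => (b i).repr (v i) k • b i k]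
  simp only [MultilinearMap.map_smul_univ, map_sum, map_smul, smul_eq_mul]
  rfl

variable [∀ i, FiniteDimensional ℂ (E i)]

/-- **A tensor product of finitely many finite-dimensional differentiable representations is
differentiable**, with the Leibniz differential. [cite: BorelWallach2000, 0 §2.3] -/
theorem isDifferentiableRep (h : ∀ i, IsDifferentiableRep G (τ i) (dτ i)) :
    IsDifferentiableRep G (piRep G τ) (piLie G dτ) where
  continuous_coeff x ℓ := by
    induction x using PiTensorProduct.induction_on with
    | smul_tprod r f =>
      let b := fun i => Module.finBasis ℂ (E i)
      have e : (fun g : G.carrier => ℓ (piRep G τ g (r • PiTensorProduct.tprod ℂ f))) =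
          fun g => r * ∑ a : (∀ i, Fin (Module.finrank ℂ (E i))),
            (∏ i, (b i).coord (a i) (τ i g (f i))) *
              ℓ (PiTensorProduct.tprod ℂ fun i => b i (a i)) := by
        funext g
        rw [map_smul, piRep_tprod, map_smul, smul_eq_mul, expand ℓ b]
      rw [e]
      refine continuous_const.mul (continuous_finsetSum _ fun a _ =>
        (continuous_finsetProd _ fun i _ => ?_).mul continuous_const)
      exact (h i).continuous_coeff (f i) ((b i).coord (a i))
    | add x y hx hy =>
      simp only [map_add]
      exact hx.add hy
  hasDerivAt_coeff X x ℓ := by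
    induction x using PiTensorProduct.induction_on with
    | smul_tprod r f =>
      let b := fun i => Module.finBasis ℂ (E i)
      have hc : ∀ (i : ι) (k : Fin (Module.finrank ℂ (E i))),
          HasDerivAt (fun t : ℝ => (b i).coord k (τ i (G.expMem (t • X)) (f i)))
            ((b i).coord k (dτ i X (f i))) 0 :=
        fun i k => (h i).hasDerivAt_coeff X (f i) ((b i).coord k)
      have hc0 : ∀ (i : ι) (k : Fin (Module.finrank ℂ (E i))),
          (b i).coord k (τ i (G.expMem ((0 : ℝ) • X)) (f i)) = (b i).coord k (f i) := by
        intro i k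
        rw [expMem_zero_smul_pi, map_one, Module.End.one_apply]
      have e : (fun t : ℝ => ℓ (piRep G τ (G.expMem (t • X)) (r • PiTensorProduct.tprod ℂ f))) =
          fun t => r * ∑ a : (∀ i, Fin (Module.finrank ℂ (E i))),
            (∏ i, (b i).coord (a i) (τ i (G.expMem (t • X)) (f i))) *
              ℓ (PiTensorProduct.tprod ℂ fun i => b i (a i)) := by
        funext t
        rw [map_smul, piRep_tprod, map_smul, smul_eq_mul, expand ℓ b]
      rw [e]
      have hprod : ∀ a : (∀ i, Fin (Module.finrank ℂ (E i))),
          HasDerivAt (fun t : ℝ => ∏ i, (b i).coord (a i) (τ i (G.expMem (t • X)) (f i)))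
            (∑ i, (∏ j ∈ Finset.univ.erase i, (b j).coord (a j) (f j)) *
              (b i).coord (a i) (dτ i X (f i))) 0 := by
        intro a
        have hd := HasDerivAt.fun_finsetProd (u := Finset.univ) (x := (0 : ℝ))
          (f := fun i t => (b i).coord (a i) (τ i (G.expMem (t • X)) (f i)))
          (fun i _ => hc i (a i))
        simp only [hc0, smul_eq_mul] at hd
        exact hd
      have hsum := HasDerivAt.fun_sum (u := Finset.univ) fun a _ =>
        (hprod a).mul_const (ℓ (PiTensorProduct.tprod ℂ fun i => b i (a i)))
      have hfin := hsum.const_mul r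
      have hval : ℓ (piLie G dτ X (r • PiTensorProduct.tprod ℂ f)) =
          r * ∑ a : (∀ i, Fin (Module.finrank ℂ (E i))),
            (∑ i, (∏ j ∈ Finset.univ.erase i, (b j).coord (a j) (f j)) *
              (b i).coord (a i) (dτ i X (f i))) *
              ℓ (PiTensorProduct.tprod ℂ fun i => b i (a i)) := by
        rw [map_smul, piLie_tprod, map_smul, smul_eq_mul, map_sum]
        congr 1
        rw [Finset.sum_congr rfl fun i _ => expand ℓ b (Function.update f i (dτ i X (f i))),
          Finset.sum_comm]
        refine Finset.sum_congr rfl fun a _ => ?_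
        rw [Finset.sum_mul]
        refine Finset.sum_congr rfl fun i _ => ?_
        congr 1
        have hu : (fun j => (b j).coord (a j) (Function.update f i (dτ i X (f i)) j)) =
            Function.update (fun j => (b j).coord (a j) (f j)) i
              ((b i).coord (a i) (dτ i X (f i))) := by
          funext j
          by_cases hji : j = i
          · subst hji
            simp only [Function.update_self]
          · simp only [Function.update_of_ne hji]
        rw [hu, Finset.prod_update_of_mem (Finset.mem_univ i), Finset.sdiff_singleton_eq_erase,
          mul_comm]
      rw [hval]
      exact hfin
    | add x y hx hy =>
      simp only [map_add]
      exact hx.add hy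

variable [StarModule ℝ A] [ContinuousStar A]

/-- **The tensor product of finitely many finite-dimensional differentiable representations,
restricted to `K`, with the Leibniz differential, is a `(𝔤, K)`-module.**
[cite: BorelWallach2000, 0 §2.4–2.5] -/
theorem isGKModule (h : ∀ i, IsDifferentiableRep G (τ i) (dτ i)) :
    IsGKModule G (restrictK G (piRep G τ)) (piLie G dτ) :=
  (isDifferentiableRep G τ dτ h).isGKModule

end PiTensor

end RealMatrixGroup

end Literature.NumberTheory.Automorphic
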